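import Summits.ABC.IUTFork.Repair.RHHullCellSlice
import Summits.ABC.IUTFork.Repair.RHCellSlackExactOrders
import Literature.IUT.LogVolume.DifferentEstimatesCorollaries
import Summits.ABC.IUTFork.Conditional.HexHullThresholdGenuine
import HarnessLib

/-!
# R-H ROUND 2, SLICE (S0) for the REAL (xi-f) licence cell: at the diagonal packet of one local field the licence cell IS
# `HullCellδ e m_q j D R_in R_out`, the two slice hypotheses are theorems of the field, so the licensed labels form `{1, …, J}` exactly

abc-iut cell, rung LADDER-ABC:A2.RESCUE.H; R-H ROUND 2 seat abc-iut-rh2-w-2 (Q1′ WEIGHTS typer 2/2, gen 3; `plan/rescue/R-H/SLICE.md` row 4 (S0),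
`MIN-SLICE.md` §(i)/(iv)). PROOF-ONLY file (0 definitions, 0 `Prop` facts, no instance): the JUNCTION of

* abc-iut-w5-d180's **cell in integer orders** `Literature.IUT.LogVolume.iota_smul_subset_packetHull_orbit_iota_smul_iff_orders` (p-landed;
  `TensorPacketLicenceCellOrders`): at the DIAGONAL packet of ONE local field `K` (all `|I|` slots equal to `K`; any `p`, any ramification) with
  norm uniformiser `ϖ`, `e = e(K/ℚ_p)`, different exponent `D` (`d_K = D/e`), inner radius `‖c_in‖ = ‖ϖ‖^{R_in}`, outer radius `‖c_out‖ = ‖ϖ‖^{R_out}`,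
  `‖t_Θ‖ = ‖ϖ‖^M`, `‖t_q‖ = ‖ϖ‖^{m_q}`: the (xi-f) inclusion `ι_{b'}(t_q)·(R_I)^∼ ⊆ hull(⋃_{g ∈ Ind2} g·ι_b(t_Θ)·(R_I)^∼)` holds
  **iff** `e·⌊(M − (|I|−1)·D − |I|·R_in)/e⌋ + |I|·R_out ≤ m_q`; and abc-iut-rh-typ-4's slack form `RHCellSlackExactOrders.cellSlack_diag_nonneg_iff_orders`
  (p483291: `0 ≤ log μ̄(hull) − log μ̄(q-box)` iff the same integer inequality);
* this seat's **SLICE (S0) for row 4** `Summits/ABC/IUTFork/Repair/RHHullCellSlice` (p480472): the integer predicate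
  `RH.DiffPricedHull.HullCellδ e m j δ r_in r_out :⟺ e·⌊(j²·m − j·δ − (j+1)·r_in)/e⌋ ≤ m − (j+1)·r_out` is downward closed in the label `j ≥ 1`
  under `0 < e`, `e − 1 ≤ δ`, `r_out ≤ r_in`, `0 ≤ m`, so its truth set in `[1, L]` is an exact initial segment `{1, …, J}`.

THE R-H LABEL DICTIONARY. The label-`j` packet of [IUTchIII] Cor. 3.12 Step (xi) has `|I| = j + 1` capsule slots and Θ-pilot depth `M = j²·m_q`
(`q^{j²/2l}` against `q^{1/2l}`; `plan/rescue/R-W/WINDOW-TABLE.tsv` columns `e_w, delta_w = D, m_q, R_in, R_out, margin_U2cell`, `tools/gen_table.py`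
l. 561–565: `margin_U2cell(w,j) = m_q − [e_w·⌊(j²m_q − j·D − (j+1)·R_in)/e_w⌋ + (j+1)·R_out]`).

WHAT IS PROVED (namespace `Summit.ABC.IUTFork.Repair.RH.HullCellSliceLicence`):
* §1 `orders_iff_hullCellδ` — at `|I| = j+1`, `M = j²·m_q` the orders predicate IS `HullCellδ e m_q j D R_in R_out` (pure `Int` bookkeeping);
  **`licence_diag_iff_hullCellδ`** — the (xi-f) licence cell at the diagonal label-`j` packet ⟺ `HullCellδ e m_q j D R_in R_out`;
  `cellSlack_diag_nonneg_iff_hullCellδ` — abc-iut-rh-typ-4's slack is `≥ 0` there ⟺ the same. So the WINDOW-TABLE predicate `margin_U2cell ≥ 0`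
  is, at a diagonal packet, THE KERNEL CELL — not a model of it.
* §2 THE TWO SLICE HYPOTHESES ARE THEOREMS OF THE FIELD: `ramificationIdx_sub_one_le_differentExp` — `e − 1 ≤ D`
  (`Literature.IUT.LogVolume.sub_one_div_le_differentOrd`, [IUTchIV] Prop. 1.3 (i) / [SerreLocalFields1979] III §6 Prop. 13);
  `outerRadius_le_innerRadius` — `R_out ≤ R_in` (`c_in = c_in·1 ∈ log_p(𝒪^×)` and `‖·‖ ≤ ‖c_out‖` on `log_p(𝒪^×)`, `‖ϖ‖ < 1`).
* §3 SLICE (S0) FOR THE REAL CELL (only `0 ≤ m_q` — an integral q-pilot — is assumed): **`licence_diag_label_one`** — the label-1 packet (2 slots,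
  depth `m_q`) is ALWAYS licensed; **`licence_diag_anti`** — licence at label `j'` and `1 ≤ j ≤ j'` give licence at label `j` (any index sets of
  the right sizes, any slot choices); **`exists_licence_sliceBoundary`** — for every `L ≥ 1` there is `J ∈ [1, L]` with: the label-`j` packet
  (`1 ≤ j ≤ L`) is licensed iff `j ≤ J`; `licence_sliceBoundary_unique`. In words: Σ₄ ∩ (the diagonal packets of one field) = `{1, …, J}` EXACTLY.
* §4 floor-free bracket for the real cell: `licence_diag_of_linear` / `linear_of_licence_diag` —
  `(j²−1)·m_q ≤ j·D + (j+1)·(R_in − R_out) ⟹ licence ⟹ (j²−1)·m_q ≤ j·D + (j+1)·(R_in − R_out) + (e − 1)` (SLICE.md row 4: slope `D + (R_in − R_out)`).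

HONEST SCOPE. One diagonal packet family of one field with prescribed integer data `(e, D, R_in, R_out, m_q)`; WHICH genuine completion carries
which integers (abc-iut-c312-3 `UnitLogMaxNorm`, abc-iut-w4-d087's local types) and the Galois descent of a packet sum to places
(abc-iut-s2 `Cor312ThetaSideGaloisDescent`) are NOT done here (abc-iut-rh-typ-4's named residuals stand); mixed tuples on non-Galois fibres carry
their own content. Nothing here decides any cell at genuine data, asserts or denies [IUTchIII] Cor. 3.12, bears on abc, or takes a side on any
author; the (Ind2)/hull are the tree's typings of disputed-corpus constructions; typed ≠ proved; instantiated ≠ endorsed.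
[claim: Mochizuki2012, status: disputed] for every IUT locution. [cite: Mochizuki2012, IUTchIII Cor. 3.12 Step (xi-f) p. 184; IUTchIV Prop. 1.1 p. 9,
Prop. 1.2 (i)(ii) p. 10, Prop. 1.3 (i) p. 12, Prop. 1.4 (iii) p. 13–14] [cite: SerreLocalFields1979, Ch. III §6 Prop. 13] [cite: DupuyHilado2025, §4.9, §4.12]
[cite: NeukirchANT1999, Ch. II (5.5)]
-/

noncomputable section

open Set Function
open scoped Pointwise

namespace Summit.ABC.IUTFork.Repair.RH.HullCellSliceLicence

open Literature.IUT.LogVolume Literature.NumberTheory.GaloisRepresentations.Ultrametric Summit.ABC.IUTFork.Cor312Vol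
  Summit.ABC.IUTFork.Repair.RH.DiffPricedHull Summit.ABC.IUTFork.Repair.RH.HullCellSlice Summit.ABC.IUTFork.Repair.RHCellSlackExactOrders

/-! ## §1. At `|I| = j + 1`, `M = j²·m_q` the orders predicate is `HullCellδ e m_q j D R_in R_out` -/

/-- **Pure integer bookkeeping**: with `|I| = j + 1` and `M = j²·m_q`,
`e·⌊(M − (|I|−1)·D − |I|·R_in)/e⌋ + |I|·R_out ≤ m_q ⟺ HullCellδ e m_q j D R_in R_out` (both sides carry the same floor). [folklore] -/
theorem orders_iff_hullCellδ (e D Rin Rout mq : ℤ) (j : ℕ) :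
    e * ((((j : ℕ) : ℤ) ^ 2 * mq - ((j + 1 - 1 : ℕ) : ℤ) * D - ((j + 1 : ℕ) : ℤ) * Rin) / e) + ((j + 1 : ℕ) : ℤ) * Rout ≤ mq ↔
      HullCellδ e mq (j : ℤ) D Rin Rout := by
  unfold HullCellδ
  have h1 : ((j + 1 - 1 : ℕ) : ℤ) = (j : ℤ) := by simp
  have h2 : ((j + 1 : ℕ) : ℤ) = (j : ℤ) + 1 := by push_cast; ring
  rw [h1, h2]
  constructor <;> intro h <;> linarith

variable (p : ℕ) [Fact p.Prime] {K : Type} [NontriviallyNormedField K] [NormedAlgebra ℚ_[p] K] [IsUltrametricDist K] [ProperSpace K]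

/-- **THE (xi-f) LICENCE CELL AT THE DIAGONAL LABEL-`j` PACKET IS `HullCellδ e m_q j D R_in R_out`.** One local field `K` in all `|I| = j + 1`
slots, norm uniformiser `ϖ`, `d_K = D/e`, `‖c_in‖ = ‖ϖ‖^{R_in}` the largest ball in `log_p(𝒪^×)`, `‖c_out‖ = ‖ϖ‖^{R_out}` the largest norm on it,
Θ-pilot of depth `j²·m_q`, q-pilot of depth `m_q`, any slots `b, b'`:
`ι_{b'}(t_q)·(R_I)^∼ ⊆ hull(⋃_{g∈Ind2} g·ι_b(t_Θ)·(R_I)^∼) ⟺ HullCellδ e m_q j D R_in R_out` — abc-iut-w5-d180's orders form read in the R-H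
label dictionary; the WINDOW-TABLE predicate `margin_U2cell(w,j) ≥ 0` verbatim.
[cite: DupuyHilado2025, §4.9, §4.12] [cite: Mochizuki2012, IUTchIV Prop. 1.1 p. 9, Prop. 1.2 (i)(ii) p. 10] [claim: Mochizuki2012, status: disputed] -/
theorem licence_diag_iff_hullCellδ {I : Type} [Fintype I] [DecidableEq I] [Nonempty I] {j : ℕ} (hI : Fintype.card I = j + 1)
    {ϖ : Kˣ} (hϖ : IsUniformizer ϖ) {D : ℕ} (hD : differentOrd p K = (D : ℝ) / absRamificationIdx p K) {cin cout : K}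
    (hin : ∀ o : K, ‖o‖ ≤ 1 → cin * o ∈ logUnits K)
    (hmax : ∃ (ϖ' : Kˣ) (w : K), IsUniformizer ϖ' ∧ w ∉ logUnits K ∧ ‖w‖ * ‖(ϖ' : K)‖ ≤ ‖cin‖)
    (houtΛ : cout ∈ logUnits K) (hdom : ∀ z ∈ logUnits K, ‖z‖ ≤ ‖cout‖)
    {Rin Rout : ℤ} (hRin : ‖cin‖ = ‖(ϖ : K)‖ ^ Rin) (hRout : ‖cout‖ = ‖(ϖ : K)‖ ^ Rout)
    (b b' : I) {tΘ tq : K} {mq : ℤ} (hΘ : ‖tΘ‖ = ‖(ϖ : K)‖ ^ ((j : ℤ) ^ 2 * mq)) (hq : ‖tq‖ = ‖(ϖ : K)‖ ^ mq) :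
    iota p (fun _ : I => K) b' tq • (normalizedPacket p (fun _ : I => K) : Set (PacketAlgebra p (fun _ : I => K))) ⊆
        packetHull p (fun _ : I => K) (⋃ g : indTwo p (fun _ : I => K),
          g • (iota p (fun _ : I => K) b tΘ • (normalizedPacket p (fun _ : I => K) : Set (PacketAlgebra p (fun _ : I => K))))) ↔
      HullCellδ (absRamificationIdx p K : ℤ) mq (j : ℤ) (D : ℤ) Rin Rout := by
  rw [iota_smul_subset_packetHull_orbit_iota_smul_iff_orders p hϖ hD hin hmax houtΛ hdom hRin hRout b b' hΘ hq, hI]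
  exact orders_iff_hullCellδ _ _ _ _ _ _

/-- **abc-iut-rh-typ-4's SLACK at the diagonal label-`j` packet is `≥ 0` iff `HullCellδ e m_q j D R_in R_out`** (slot family `x` with every
`‖x_a‖ = ‖ϖ‖^{j²·m_q}`): `0 ≤ log μ̄(hull(Ind2·⋃_a ι_a(x_a)·(R_I)^∼)) − log μ̄(ι_{b'}(t_q)·(R_I)^∼) ⟺ HullCellδ …` — the SIGN of the G2-credit bracket
`(log p/e)·marg` is the table cell. [cite: DupuyHilado2025, §4.12] [claim: Mochizuki2012, status: disputed] -/
theorem cellSlack_diag_nonneg_iff_hullCellδ {I : Type} [Fintype I] [DecidableEq I] [Nonempty I] {j : ℕ} (hI : Fintype.card I = j + 1)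
    {ϖ : Kˣ} (hϖ : IsUniformizer ϖ) {D : ℕ} (hD : differentOrd p K = (D : ℝ) / absRamificationIdx p K) {cin cout : K}
    (hin : ∀ o : K, ‖o‖ ≤ 1 → cin * o ∈ logUnits K)
    (hmax : ∃ (ϖ' : Kˣ) (w : K), IsUniformizer ϖ' ∧ w ∉ logUnits K ∧ ‖w‖ * ‖(ϖ' : K)‖ ≤ ‖cin‖)
    (houtΛ : cout ∈ logUnits K) (hdom : ∀ z ∈ logUnits K, ‖z‖ ≤ ‖cout‖)
    {Rin Rout : ℤ} (hRin : ‖cin‖ = ‖(ϖ : K)‖ ^ Rin) (hRout : ‖cout‖ = ‖(ϖ : K)‖ ^ Rout)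
    {x : I → K} {mq : ℤ} (hx : ∀ a, ‖x a‖ = ‖(ϖ : K)‖ ^ ((j : ℤ) ^ 2 * mq)) (b' : I) {tq : K} (hq : ‖tq‖ = ‖(ϖ : K)‖ ^ mq) :
    0 ≤ packetLogμ p (fun _ : I => K) (packetHull p (fun _ : I => K) (⋃ g : indTwo p (fun _ : I => K),
            g • ⋃ a, iota p (fun _ : I => K) a (x a) • (normalizedPacket p (fun _ : I => K) : Set (PacketAlgebra p (fun _ : I => K))))) -
          packetLogμ p (fun _ : I => K)
            (iota p (fun _ : I => K) b' tq • (normalizedPacket p (fun _ : I => K) : Set (PacketAlgebra p (fun _ : I => K)))) ↔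
      HullCellδ (absRamificationIdx p K : ℤ) mq (j : ℤ) (D : ℤ) Rin Rout := by
  rw [cellSlack_diag_nonneg_iff_orders p hϖ hD hin hmax houtΛ hdom hRin hRout hx b' hq, hI]
  exact orders_iff_hullCellδ _ _ _ _ _ _

/-! ## §2. The two slice hypotheses are theorems of the field -/

/-- **`e − 1 ≤ D`**: the different exponent of a `p`-adic field is at least `e − 1` ([IUTchIV] Prop. 1.3 (i): `d_K ≥ (e−1)/e`;
[SerreLocalFields1979] III §6 Prop. 13, equality iff tame). Integer form over `Literature.IUT.LogVolume.sub_one_div_le_differentOrd`.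
[cite: SerreLocalFields1979, Ch. III §6 Prop. 13] -/
theorem ramificationIdx_sub_one_le_differentExp {D : ℕ} (hD : differentOrd p K = (D : ℝ) / absRamificationIdx p K) :
    (absRamificationIdx p K : ℤ) - 1 ≤ (D : ℤ) := by
  have he : (0 : ℝ) < absRamificationIdx p K := by exact_mod_cast absRamificationIdx_pos p K
  have h := sub_one_div_le_differentOrd p K
  rw [hD, div_le_div_iff_of_pos_right he] at h
  have h' : ((absRamificationIdx p K : ℤ) : ℝ) - 1 ≤ ((D : ℤ) : ℝ) := by push_cast; exact h
  exact_mod_cast h'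

omit [IsUltrametricDist K] [ProperSpace K] in
/-- **`R_out ≤ R_in`**: the largest ball inside `log_p(𝒪^×)` has radius at most the largest norm on `log_p(𝒪^×)` — `c_in = c_in·1 ∈ log_p(𝒪^×)`,
so `‖ϖ‖^{R_in} = ‖c_in‖ ≤ ‖c_out‖ = ‖ϖ‖^{R_out}` with `0 < ‖ϖ‖ < 1`. [folklore] -/
theorem outerRadius_le_innerRadius {ϖ : Kˣ} (hϖ : IsUniformizer ϖ) {cin cout : K}
    (hin : ∀ o : K, ‖o‖ ≤ 1 → cin * o ∈ logUnits K) (hdom : ∀ z ∈ logUnits K, ‖z‖ ≤ ‖cout‖)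
    {Rin Rout : ℤ} (hRin : ‖cin‖ = ‖(ϖ : K)‖ ^ Rin) (hRout : ‖cout‖ = ‖(ϖ : K)‖ ^ Rout) : Rout ≤ Rin := by
  have h1 : cin ∈ logUnits K := by simpa using hin 1 (by simp)
  have h2 : ‖cin‖ ≤ ‖cout‖ := hdom _ h1
  rw [hRin, hRout] at h2
  exact (zpow_le_zpow_iff_right_of_lt_one₀ (norm_units_pos ϖ) hϖ.norm_lt_one).1 h2

/-! ## §3. SLICE (S0) for the real cell: `{labels j : the diagonal label-j packet is licensed} = {1, …, J}` -/

/-- **THE LABEL-1 PACKET IS ALWAYS LICENSED** (2 slots, Θ-depth `m_q = 1²·m_q`; any `m_q`, any local field): demand `(1²−1)·m_q = 0`, price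
`D + 2(R_in − R_out) ≥ 0`. The `j = 1` cell of Σ₄ at every place (SLICE.md) for the real (xi-f) inclusion.
[cite: DupuyHilado2025, §4.12] [claim: Mochizuki2012, status: disputed] -/
theorem licence_diag_label_one {I : Type} [Fintype I] [DecidableEq I] [Nonempty I] (hI : Fintype.card I = 2)
    {ϖ : Kˣ} (hϖ : IsUniformizer ϖ) {D : ℕ} (hD : differentOrd p K = (D : ℝ) / absRamificationIdx p K) {cin cout : K}
    (hin : ∀ o : K, ‖o‖ ≤ 1 → cin * o ∈ logUnits K)
    (hmax : ∃ (ϖ' : Kˣ) (w : K), IsUniformizer ϖ' ∧ w ∉ logUnits K ∧ ‖w‖ * ‖(ϖ' : K)‖ ≤ ‖cin‖)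
    (houtΛ : cout ∈ logUnits K) (hdom : ∀ z ∈ logUnits K, ‖z‖ ≤ ‖cout‖)
    {Rin Rout : ℤ} (hRin : ‖cin‖ = ‖(ϖ : K)‖ ^ Rin) (hRout : ‖cout‖ = ‖(ϖ : K)‖ ^ Rout)
    (b b' : I) {tΘ tq : K} {mq : ℤ} (hΘ : ‖tΘ‖ = ‖(ϖ : K)‖ ^ mq) (hq : ‖tq‖ = ‖(ϖ : K)‖ ^ mq) :
    iota p (fun _ : I => K) b' tq • (normalizedPacket p (fun _ : I => K) : Set (PacketAlgebra p (fun _ : I => K))) ⊆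
        packetHull p (fun _ : I => K) (⋃ g : indTwo p (fun _ : I => K),
          g • (iota p (fun _ : I => K) b tΘ • (normalizedPacket p (fun _ : I => K) : Set (PacketAlgebra p (fun _ : I => K))))) := by
  have hΘ' : ‖tΘ‖ = ‖(ϖ : K)‖ ^ (((1 : ℕ) : ℤ) ^ 2 * mq) := by rw [hΘ]; norm_num
  rw [licence_diag_iff_hullCellδ p (j := 1) hI hϖ hD hin hmax houtΛ hdom hRin hRout b b' hΘ' hq]
  have he : (0 : ℤ) < absRamificationIdx p K := by exact_mod_cast absRamificationIdx_pos p K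
  exact_mod_cast hullCellδ_one (m := mq) he (ramificationIdx_sub_one_le_differentExp p hD)
    (outerRadius_le_innerRadius hϖ hin hdom hRin hRout)

/-- **LICENCE IS ANTITONE IN THE LABEL**: if the diagonal label-`j'` packet (`|I'| = j'+1` slots, Θ-depth `j'²·m_q`) is licensed and `1 ≤ j ≤ j'`,
then the label-`j` packet (`|I| = j+1`, Θ-depth `j²·m_q`) is licensed — for an integral q-pilot (`0 ≤ m_q`), any slot choices, every local field.
(§1 + this seat's `HullCellSlice.hullCellδ_anti` + §2.) [cite: DupuyHilado2025, §4.12] [claim: Mochizuki2012, status: disputed] -/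
theorem licence_diag_anti {I I' : Type} [Fintype I] [DecidableEq I] [Nonempty I] [Fintype I'] [DecidableEq I'] [Nonempty I']
    {j j' : ℕ} (hI : Fintype.card I = j + 1) (hI' : Fintype.card I' = j' + 1) (hj : 1 ≤ j) (hjj : j ≤ j')
    {ϖ : Kˣ} (hϖ : IsUniformizer ϖ) {D : ℕ} (hD : differentOrd p K = (D : ℝ) / absRamificationIdx p K) {cin cout : K}
    (hin : ∀ o : K, ‖o‖ ≤ 1 → cin * o ∈ logUnits K)
    (hmax : ∃ (ϖ' : Kˣ) (w : K), IsUniformizer ϖ' ∧ w ∉ logUnits K ∧ ‖w‖ * ‖(ϖ' : K)‖ ≤ ‖cin‖)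
    (houtΛ : cout ∈ logUnits K) (hdom : ∀ z ∈ logUnits K, ‖z‖ ≤ ‖cout‖)
    {Rin Rout : ℤ} (hRin : ‖cin‖ = ‖(ϖ : K)‖ ^ Rin) (hRout : ‖cout‖ = ‖(ϖ : K)‖ ^ Rout) {mq : ℤ} (hmq : 0 ≤ mq)
    (b b' : I) {tΘ tq : K} (hΘ : ‖tΘ‖ = ‖(ϖ : K)‖ ^ ((j : ℤ) ^ 2 * mq)) (hq : ‖tq‖ = ‖(ϖ : K)‖ ^ mq)
    (c c' : I') {tΘ' tq' : K} (hΘ' : ‖tΘ'‖ = ‖(ϖ : K)‖ ^ ((j' : ℤ) ^ 2 * mq)) (hq' : ‖tq'‖ = ‖(ϖ : K)‖ ^ mq)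
    (h : iota p (fun _ : I' => K) c' tq' • (normalizedPacket p (fun _ : I' => K) : Set (PacketAlgebra p (fun _ : I' => K))) ⊆
        packetHull p (fun _ : I' => K) (⋃ g : indTwo p (fun _ : I' => K),
          g • (iota p (fun _ : I' => K) c tΘ' • (normalizedPacket p (fun _ : I' => K) : Set (PacketAlgebra p (fun _ : I' => K)))))) :
    iota p (fun _ : I => K) b' tq • (normalizedPacket p (fun _ : I => K) : Set (PacketAlgebra p (fun _ : I => K))) ⊆
        packetHull p (fun _ : I => K) (⋃ g : indTwo p (fun _ : I => K),
          g • (iota p (fun _ : I => K) b tΘ • (normalizedPacket p (fun _ : I => K) : Set (PacketAlgebra p (fun _ : I => K))))) := by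
  rw [licence_diag_iff_hullCellδ p hI' hϖ hD hin hmax houtΛ hdom hRin hRout c c' hΘ' hq'] at h
  rw [licence_diag_iff_hullCellδ p hI hϖ hD hin hmax houtΛ hdom hRin hRout b b' hΘ hq]
  have he : (0 : ℤ) < absRamificationIdx p K := by exact_mod_cast absRamificationIdx_pos p K
  exact hullCellδ_anti he (ramificationIdx_sub_one_le_differentExp p hD) (outerRadius_le_innerRadius hϖ hin hdom hRin hRout) hmq
    (by exact_mod_cast hj) (by exact_mod_cast hjj) h

/-- **SLICE (S0) FOR THE REAL LICENCE CELL.** At the diagonal packets of one local field with an integral q-pilot (`0 ≤ m_q`): for every label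
range `L ≥ 1` (read `L = l⋇`) there is `J ∈ [1, L]` such that, for every `1 ≤ j ≤ L`, EVERY index set of size `j + 1`, every slot choice and every
Θ- and q-pilots of depths `j²·m_q` and `m_q`, the (xi-f) licence inclusion holds iff `j ≤ J` — the licensed labels are the INITIAL SEGMENT `{1, …, J}`,
no sporadic labels, at every local type (tame, boundary, wild, deep) the field `K` may have. (§1 + this seat's `HullCellSlice.exists_sliceBoundary`
+ §2.) [cite: DupuyHilado2025, §4.12] [cite: Mochizuki2012, IUTchIII Cor. 3.12 Step (xi-f) p. 184] [claim: Mochizuki2012, status: disputed] -/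
theorem exists_licence_sliceBoundary {ϖ : Kˣ} (hϖ : IsUniformizer ϖ) {D : ℕ} (hD : differentOrd p K = (D : ℝ) / absRamificationIdx p K)
    {cin cout : K} (hin : ∀ o : K, ‖o‖ ≤ 1 → cin * o ∈ logUnits K)
    (hmax : ∃ (ϖ' : Kˣ) (w : K), IsUniformizer ϖ' ∧ w ∉ logUnits K ∧ ‖w‖ * ‖(ϖ' : K)‖ ≤ ‖cin‖)
    (houtΛ : cout ∈ logUnits K) (hdom : ∀ z ∈ logUnits K, ‖z‖ ≤ ‖cout‖)
    {Rin Rout : ℤ} (hRin : ‖cin‖ = ‖(ϖ : K)‖ ^ Rin) (hRout : ‖cout‖ = ‖(ϖ : K)‖ ^ Rout) {mq : ℤ} (hmq : 0 ≤ mq)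
    {L : ℕ} (hL : 1 ≤ L) :
    ∃ J : ℕ, 1 ≤ J ∧ J ≤ L ∧ ∀ j : ℕ, 1 ≤ j → j ≤ L →
      ∀ (I : Type) [Fintype I] [DecidableEq I] [Nonempty I], Fintype.card I = j + 1 →
      ∀ (b b' : I) (tΘ tq : K), ‖tΘ‖ = ‖(ϖ : K)‖ ^ ((j : ℤ) ^ 2 * mq) → ‖tq‖ = ‖(ϖ : K)‖ ^ mq →
        (iota p (fun _ : I => K) b' tq • (normalizedPacket p (fun _ : I => K) : Set (PacketAlgebra p (fun _ : I => K))) ⊆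
            packetHull p (fun _ : I => K) (⋃ g : indTwo p (fun _ : I => K),
              g • (iota p (fun _ : I => K) b tΘ • (normalizedPacket p (fun _ : I => K) : Set (PacketAlgebra p (fun _ : I => K))))) ↔
          j ≤ J) := by
  have he : (0 : ℤ) < absRamificationIdx p K := by exact_mod_cast absRamificationIdx_pos p K
  obtain ⟨J, hJ1, hJL, hJ⟩ := exists_sliceBoundary (m := mq) (δ := (D : ℤ)) he (ramificationIdx_sub_one_le_differentExp p hD)
    (outerRadius_le_innerRadius hϖ hin hdom hRin hRout) hmq (L := (L : ℤ)) (by exact_mod_cast hL)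
  refine ⟨J.toNat, by omega, by omega, fun j hj hjL I _ _ _ hI b b' tΘ tq hΘ hq => ?_⟩
  rw [licence_diag_iff_hullCellδ p hI hϖ hD hin hmax houtΛ hdom hRin hRout b b' hΘ hq,
    hJ (j : ℤ) (by exact_mod_cast hj) (by exact_mod_cast hjL)]
  omega

/-- **The boundary is unique**: two labels `J, J' ≥ 1` that are licensed while `J+1, J'+1` are not (at diagonal packets of the right sizes and
depths) coincide. (§1 + `HullCellSlice.sliceBoundary_unique` + §2.) [cite: DupuyHilado2025, §4.12] [claim: Mochizuki2012, status: disputed] -/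
theorem licence_sliceBoundary_unique {ϖ : Kˣ} (hϖ : IsUniformizer ϖ) {D : ℕ} (hD : differentOrd p K = (D : ℝ) / absRamificationIdx p K)
    {cin cout : K} (hin : ∀ o : K, ‖o‖ ≤ 1 → cin * o ∈ logUnits K) (hdom : ∀ z ∈ logUnits K, ‖z‖ ≤ ‖cout‖)
    {Rin Rout : ℤ} (hRin : ‖cin‖ = ‖(ϖ : K)‖ ^ Rin) (hRout : ‖cout‖ = ‖(ϖ : K)‖ ^ Rout) {mq : ℤ} (hmq : 0 ≤ mq)
    {J J' : ℕ} (hJ : 1 ≤ J) (hJ' : 1 ≤ J')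
    (hin₁ : HullCellδ (absRamificationIdx p K : ℤ) mq (J : ℤ) (D : ℤ) Rin Rout)
    (hoff₁ : ¬ HullCellδ (absRamificationIdx p K : ℤ) mq ((J : ℤ) + 1) (D : ℤ) Rin Rout)
    (hin₂ : HullCellδ (absRamificationIdx p K : ℤ) mq (J' : ℤ) (D : ℤ) Rin Rout)
    (hoff₂ : ¬ HullCellδ (absRamificationIdx p K : ℤ) mq ((J' : ℤ) + 1) (D : ℤ) Rin Rout) : J = J' := by
  have he : (0 : ℤ) < absRamificationIdx p K := by exact_mod_cast absRamificationIdx_pos p K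
  have := sliceBoundary_unique he (ramificationIdx_sub_one_le_differentExp p hD) (outerRadius_le_innerRadius hϖ hin hdom hRin hRout) hmq
    (by exact_mod_cast hJ) (by exact_mod_cast hJ') hin₁ hoff₁ hin₂ hoff₂
  exact_mod_cast this

/-! ## §4. The floor-free bracket for the real cell (SLICE.md row 4: slope `D + (R_in − R_out)`) -/

/-- **Floor-free SUFFICIENT condition for licence** at the diagonal label-`j` packet:
`(j²−1)·m_q ≤ j·D + (j+1)·(R_in − R_out) ⟹` the (xi-f) inclusion. (§1 + `HullCellSlice.hullCellδ_of_linear`.)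
[cite: DupuyHilado2025, §4.12] [claim: Mochizuki2012, status: disputed] -/
theorem licence_diag_of_linear {I : Type} [Fintype I] [DecidableEq I] [Nonempty I] {j : ℕ} (hI : Fintype.card I = j + 1)
    {ϖ : Kˣ} (hϖ : IsUniformizer ϖ) {D : ℕ} (hD : differentOrd p K = (D : ℝ) / absRamificationIdx p K) {cin cout : K}
    (hin : ∀ o : K, ‖o‖ ≤ 1 → cin * o ∈ logUnits K)
    (hmax : ∃ (ϖ' : Kˣ) (w : K), IsUniformizer ϖ' ∧ w ∉ logUnits K ∧ ‖w‖ * ‖(ϖ' : K)‖ ≤ ‖cin‖)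
    (houtΛ : cout ∈ logUnits K) (hdom : ∀ z ∈ logUnits K, ‖z‖ ≤ ‖cout‖)
    {Rin Rout : ℤ} (hRin : ‖cin‖ = ‖(ϖ : K)‖ ^ Rin) (hRout : ‖cout‖ = ‖(ϖ : K)‖ ^ Rout)
    (b b' : I) {tΘ tq : K} {mq : ℤ} (hΘ : ‖tΘ‖ = ‖(ϖ : K)‖ ^ ((j : ℤ) ^ 2 * mq)) (hq : ‖tq‖ = ‖(ϖ : K)‖ ^ mq)
    (h : ((j : ℤ) ^ 2 - 1) * mq ≤ (j : ℤ) * D + ((j : ℤ) + 1) * (Rin - Rout)) :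
    iota p (fun _ : I => K) b' tq • (normalizedPacket p (fun _ : I => K) : Set (PacketAlgebra p (fun _ : I => K))) ⊆
        packetHull p (fun _ : I => K) (⋃ g : indTwo p (fun _ : I => K),
          g • (iota p (fun _ : I => K) b tΘ • (normalizedPacket p (fun _ : I => K) : Set (PacketAlgebra p (fun _ : I => K))))) := by
  rw [licence_diag_iff_hullCellδ p hI hϖ hD hin hmax houtΛ hdom hRin hRout b b' hΘ hq]
  have he : (0 : ℤ) < absRamificationIdx p K := by exact_mod_cast absRamificationIdx_pos p K
  exact hullCellδ_of_linear he h

/-- **Floor-free NECESSARY condition for licence** at the diagonal label-`j` packet: the (xi-f) inclusion gives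
`(j²−1)·m_q ≤ j·D + (j+1)·(R_in − R_out) + (e − 1)`. (§1 + `HullCellSlice.linear_of_hullCellδ`.) Together with `licence_diag_of_linear`: the real
cell's boundary has slope `D + (R_in − R_out)` and constant in `[m_q + R_in − R_out, m_q + R_in − R_out + e − 1]` (SLICE.md row 4, exact).
[cite: DupuyHilado2025, §4.12] [claim: Mochizuki2012, status: disputed] -/
theorem linear_of_licence_diag {I : Type} [Fintype I] [DecidableEq I] [Nonempty I] {j : ℕ} (hI : Fintype.card I = j + 1)
    {ϖ : Kˣ} (hϖ : IsUniformizer ϖ) {D : ℕ} (hD : differentOrd p K = (D : ℝ) / absRamificationIdx p K) {cin cout : K}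
    (hin : ∀ o : K, ‖o‖ ≤ 1 → cin * o ∈ logUnits K)
    (hmax : ∃ (ϖ' : Kˣ) (w : K), IsUniformizer ϖ' ∧ w ∉ logUnits K ∧ ‖w‖ * ‖(ϖ' : K)‖ ≤ ‖cin‖)
    (houtΛ : cout ∈ logUnits K) (hdom : ∀ z ∈ logUnits K, ‖z‖ ≤ ‖cout‖)
    {Rin Rout : ℤ} (hRin : ‖cin‖ = ‖(ϖ : K)‖ ^ Rin) (hRout : ‖cout‖ = ‖(ϖ : K)‖ ^ Rout)
    (b b' : I) {tΘ tq : K} {mq : ℤ} (hΘ : ‖tΘ‖ = ‖(ϖ : K)‖ ^ ((j : ℤ) ^ 2 * mq)) (hq : ‖tq‖ = ‖(ϖ : K)‖ ^ mq)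
    (h : iota p (fun _ : I => K) b' tq • (normalizedPacket p (fun _ : I => K) : Set (PacketAlgebra p (fun _ : I => K))) ⊆
        packetHull p (fun _ : I => K) (⋃ g : indTwo p (fun _ : I => K),
          g • (iota p (fun _ : I => K) b tΘ • (normalizedPacket p (fun _ : I => K) : Set (PacketAlgebra p (fun _ : I => K)))))) :
    ((j : ℤ) ^ 2 - 1) * mq ≤ (j : ℤ) * D + ((j : ℤ) + 1) * (Rin - Rout) + ((absRamificationIdx p K : ℤ) - 1) := by
  rw [licence_diag_iff_hullCellδ p hI hϖ hD hin hmax houtΛ hdom hRin hRout b b' hΘ hq] at h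
  have he : (0 : ℤ) < absRamificationIdx p K := by exact_mod_cast absRamificationIdx_pos p K
  exact linear_of_hullCellδ he h


/-! ## §5. Binder-free forms: (S0) at the diagonal packets of EVERY `p`-adic field (APPEND, gen 3 delivery 2)

The integer data `(D, c_in, c_out, R_in, R_out)` of §1–§4 EXIST for every `p`-adic field `K` (`[NormedAlgebra ℚ_[p] K] [IsUltrametricDist K]
[ProperSpace K]`): the different exponent by `Literature.IUT.LogVolume.exists_different_generator_exponent` (abc-iut D-lane, [SerreLocalFields1979]
III §6 Prop. 13), the inner / outer radii of `log_p(𝒪_K^×)` by abc-iut-rh-typ-4's genuine-`K` engine `Conditional.HexHullThreshold.exists_innerRadius` /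
`exists_outerRadius` (p473071), their exponents by the norm uniformiser (`IsUniformizer`: every unit's norm is a `ϖ`-power). So the (S0)
statements hold with NO radius / different binders at all. -/

open scoped NormedField in
/-- **The field's integer orders exist**: for every `p`-adic field `K` and norm uniformiser `ϖ` there are `D : ℕ` with `d_K = D/e`, an inner radius
`c_in` (maximal ball `c_in·𝒪_K ⊆ log_p(𝒪_K^×)`, with the maximality witness), an outer radius `c_out ∈ log_p(𝒪_K^×)` of largest norm, and
`R_in, R_out : ℤ` with `‖c_in‖ = ‖ϖ‖^{R_in}`, `‖c_out‖ = ‖ϖ‖^{R_out}` — exactly the binder block of §1–§4 (abc-iut-w5-d180 / abc-iut-rh-typ-4).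
[cite: SerreLocalFields1979, Ch. III §6 Prop. 13] [cite: Mochizuki2012, IUTchIV Prop. 1.2 (i) p. 10] [claim: Mochizuki2012, status: disputed] -/
theorem exists_orders_data {ϖ : Kˣ} (hϖ : IsUniformizer ϖ) :
    ∃ (D : ℕ) (cin cout : K) (Rin Rout : ℤ), differentOrd p K = (D : ℝ) / absRamificationIdx p K ∧
      (∀ o : K, ‖o‖ ≤ 1 → cin * o ∈ logUnits K) ∧
      (∃ (ϖ' : Kˣ) (w : K), IsUniformizer ϖ' ∧ w ∉ logUnits K ∧ ‖w‖ * ‖(ϖ' : K)‖ ≤ ‖cin‖) ∧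
      cout ∈ logUnits K ∧ (∀ z ∈ logUnits K, ‖z‖ ≤ ‖cout‖) ∧
      ‖cin‖ = ‖(ϖ : K)‖ ^ Rin ∧ ‖cout‖ = ‖(ϖ : K)‖ ^ Rout := by
  obtain ⟨ϖ₀, hϖ₀⟩ := IsDiscreteValuationRing.exists_irreducible (Valued.integer K)
  obtain ⟨-, D, -, -, hD, -, -, -⟩ := exists_different_generator_exponent p K hϖ₀
  obtain ⟨cin, ϖ₁, w, hcin0, hin, hϖ₁, hw, hle⟩ := Conditional.HexHullThreshold.exists_innerRadius p K
  obtain ⟨cout, hout, hcout0, hdom⟩ := Conditional.HexHullThreshold.exists_outerRadius p K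
  obtain ⟨Rin, hRin⟩ := hϖ.2 (Units.mk0 cin hcin0)
  obtain ⟨Rout, hRout⟩ := hϖ.2 (Units.mk0 cout hcout0)
  exact ⟨D, cin, cout, Rin, Rout, hD, hin, ⟨ϖ₁, w, hϖ₁, hw, hle⟩, hout, hdom, by simpa using hRin, by simpa using hRout⟩

/-- **THE LABEL-1 PACKET IS LICENSED AT EVERY `p`-ADIC FIELD, with no binder at all**: one field `K` in 2 slots, Θ- and q-pilots of the SAME
non-zero norm (`‖t_Θ‖ = ‖t_q‖ ≠ 0`, the label-1 dictionary `q^{1²} = q`), any slots `b, b'`: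
`ι_{b'}(t_q)·(R_I)^∼ ⊆ hull(⋃_{g∈Ind2} g·ι_b(t_Θ)·(R_I)^∼)`. (§3 `licence_diag_label_one` + `exists_orders_data` + `exists_isUniformizer`.)
[cite: DupuyHilado2025, §4.12] [cite: Mochizuki2012, IUTchIII Cor. 3.12 Step (xi-f) p. 184] [claim: Mochizuki2012, status: disputed] -/
theorem licence_diag_label_one_field {I : Type} [Fintype I] [DecidableEq I] [Nonempty I] (hI : Fintype.card I = 2)
    (b b' : I) {tΘ tq : K} (hq0 : tq ≠ 0) (hΘq : ‖tΘ‖ = ‖tq‖) :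
    iota p (fun _ : I => K) b' tq • (normalizedPacket p (fun _ : I => K) : Set (PacketAlgebra p (fun _ : I => K))) ⊆
        packetHull p (fun _ : I => K) (⋃ g : indTwo p (fun _ : I => K),
          g • (iota p (fun _ : I => K) b tΘ • (normalizedPacket p (fun _ : I => K) : Set (PacketAlgebra p (fun _ : I => K))))) := by
  obtain ⟨ϖ, hϖ⟩ := exists_isUniformizer (F := K)
  obtain ⟨D, cin, cout, Rin, Rout, hD, hin, hmax, hout, hdom, hRin, hRout⟩ := exists_orders_data p hϖ
  obtain ⟨mq, hmq⟩ := hϖ.2 (Units.mk0 tq hq0)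
  have hq : ‖tq‖ = ‖(ϖ : K)‖ ^ mq := by simpa using hmq
  exact licence_diag_label_one p hI hϖ hD hin hmax hout hdom hRin hRout b b' (hΘq.trans hq) hq

/-- **LICENCE IS ANTITONE IN THE LABEL AT EVERY `p`-ADIC FIELD, binder-free**: norm uniformiser `ϖ`, integral q-pilot depth `m_q ≥ 0`; if the
diagonal label-`j'` packet (`j'+1` slots, Θ-depth `j'²·m_q`) is licensed and `1 ≤ j ≤ j'`, so is the label-`j` packet (`j+1` slots, Θ-depth
`j²·m_q`) — any index sets of the right sizes, any slots. (§3 `licence_diag_anti` + `exists_orders_data`.)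
[cite: DupuyHilado2025, §4.12] [claim: Mochizuki2012, status: disputed] -/
theorem licence_diag_anti_field {I I' : Type} [Fintype I] [DecidableEq I] [Nonempty I] [Fintype I'] [DecidableEq I'] [Nonempty I']
    {j j' : ℕ} (hI : Fintype.card I = j + 1) (hI' : Fintype.card I' = j' + 1) (hj : 1 ≤ j) (hjj : j ≤ j')
    {ϖ : Kˣ} (hϖ : IsUniformizer ϖ) {mq : ℤ} (hmq : 0 ≤ mq)
    (b b' : I) {tΘ tq : K} (hΘ : ‖tΘ‖ = ‖(ϖ : K)‖ ^ ((j : ℤ) ^ 2 * mq)) (hq : ‖tq‖ = ‖(ϖ : K)‖ ^ mq)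
    (c c' : I') {tΘ' tq' : K} (hΘ' : ‖tΘ'‖ = ‖(ϖ : K)‖ ^ ((j' : ℤ) ^ 2 * mq)) (hq' : ‖tq'‖ = ‖(ϖ : K)‖ ^ mq)
    (h : iota p (fun _ : I' => K) c' tq' • (normalizedPacket p (fun _ : I' => K) : Set (PacketAlgebra p (fun _ : I' => K))) ⊆
        packetHull p (fun _ : I' => K) (⋃ g : indTwo p (fun _ : I' => K),
          g • (iota p (fun _ : I' => K) c tΘ' • (normalizedPacket p (fun _ : I' => K) : Set (PacketAlgebra p (fun _ : I' => K)))))) :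
    iota p (fun _ : I => K) b' tq • (normalizedPacket p (fun _ : I => K) : Set (PacketAlgebra p (fun _ : I => K))) ⊆
        packetHull p (fun _ : I => K) (⋃ g : indTwo p (fun _ : I => K),
          g • (iota p (fun _ : I => K) b tΘ • (normalizedPacket p (fun _ : I => K) : Set (PacketAlgebra p (fun _ : I => K))))) := by
  obtain ⟨D, cin, cout, Rin, Rout, hD, hin, hmax, hout, hdom, hRin, hRout⟩ := exists_orders_data p hϖ
  exact licence_diag_anti p hI hI' hj hjj hϖ hD hin hmax hout hdom hRin hRout hmq b b' hΘ hq c c' hΘ' hq' h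

/-- **SLICE (S0) FOR THE REAL LICENCE CELL AT EVERY `p`-ADIC FIELD, binder-free.** For every `p`-adic field `K`, norm uniformiser `ϖ`, integral
q-pilot depth `m_q ≥ 0` and label range `L ≥ 1` there is `J ∈ [1, L]` such that for every `1 ≤ j ≤ L`, every index set of size `j + 1`, every
slot choice and every pilot pair of depths `j²·m_q`, `m_q`: the (xi-f) inclusion holds iff `j ≤ J`. The licensed labels at the diagonal packets of
one field are an EXACT INITIAL SEGMENT — the SLICE.md (S0) sentence for row 4 with NO hypothesis beyond `0 ≤ m_q`.
(§3 `exists_licence_sliceBoundary` + `exists_orders_data`.) [cite: DupuyHilado2025, §4.12] [cite: Mochizuki2012, IUTchIII Cor. 3.12 Step (xi-f) p. 184]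
[claim: Mochizuki2012, status: disputed] -/
theorem exists_licence_sliceBoundary_field {ϖ : Kˣ} (hϖ : IsUniformizer ϖ) {mq : ℤ} (hmq : 0 ≤ mq) {L : ℕ} (hL : 1 ≤ L) :
    ∃ J : ℕ, 1 ≤ J ∧ J ≤ L ∧ ∀ j : ℕ, 1 ≤ j → j ≤ L →
      ∀ (I : Type) [Fintype I] [DecidableEq I] [Nonempty I], Fintype.card I = j + 1 →
      ∀ (b b' : I) (tΘ tq : K), ‖tΘ‖ = ‖(ϖ : K)‖ ^ ((j : ℤ) ^ 2 * mq) → ‖tq‖ = ‖(ϖ : K)‖ ^ mq →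
        (iota p (fun _ : I => K) b' tq • (normalizedPacket p (fun _ : I => K) : Set (PacketAlgebra p (fun _ : I => K))) ⊆
            packetHull p (fun _ : I => K) (⋃ g : indTwo p (fun _ : I => K),
              g • (iota p (fun _ : I => K) b tΘ • (normalizedPacket p (fun _ : I => K) : Set (PacketAlgebra p (fun _ : I => K))))) ↔
          j ≤ J) := by
  obtain ⟨D, cin, cout, Rin, Rout, hD, hin, hmax, hout, hdom, hRin, hRout⟩ := exists_orders_data p hϖ
  exact exists_licence_sliceBoundary p hϖ hD hin hmax hout hdom hRin hRout hmq hL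

end Summit.ABC.IUTFork.Repair.RH.HullCellSliceLicence

end
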